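import Summits.BirchSwinnertonDyer.BirchSwinnertonDyer.Theorems.GenusKolyvaginAtTwoK4NegPhantomCellSupply
import HarnessLib

/-!
# Route `GenusKolyvaginAtTwo`, crux K₄⁻ `K4Neg` (stmt-BirchSwinnertonDyer-31526) — THE PHANTOM CELL'S RESIDUAL AS ONE LEVEL-4 HALVING BIT

LEAD seat `bsd-line-gk2-p1` g28, `--supports stmt-BirchSwinnertonDyer-31526 --as helper`.  THEOREMS ONLY; no `sorry`.  **BSD is NOT proved here;
K4Neg is NOT proved; nothing is closed.**  Sequel of `…K4NegPhantomCellSupply` (K4Neg's conclusion on every `Δ < 0` frame from `BSD₂(E)`,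
`BSD₂(Wd)`, Q2, PRINT and the all-level descent hypothesis `hDesc` on `y_K`).  Here `hDesc` is REDUCED to ONE frame-level, level-`4` statement
`hHalf`: **«a `K`-rational point that is halvable by a point fixed by `Γ_{K(E[4])}` is halvable in `E(K)`»** — i.e. no Kummer class `κ₂(R)`,
`R ∈ E(K)`, is the Lawson–Wuthrich phantom over `K` (on the rank-one cell: the generator of `E(K) ⊗ ℤ₂` is not halvable over `K(E[4])`, equivalently
`ξ_E` is not the twin's `2`-Selmer class).  Tools: Lawson–Wuthrich over `K` (`2φ = 0` for a phantom), the Kummer sequence (`κ(2P) = 0 ⟹ 2P ∈ 2^M E(K)`,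
no `2`-torsion), the change of level `κ_(2^M)(2^(M−1) R) = ι κ₂(R)`, and the `K`-side KLW level reduction
`Lw2PhantomExclusion.forall_torsionFixing_four_h1Eval_eq_zero_of_pow_baseChange` (a class of `H¹(K, E[2])` dying on `Γ_{K(E[2^L])}` dies on
`Γ_{K(E[4])}`).  Main theorem `kFourNeg_conclusion_of_bsdp_pair_of_halvingBit`: **K4Neg's conclusion on ANY `Δ < 0` K₄⁻-type frame from
`BSD₂(E)` + `BSD₂(Wd)` + Q2 + PRINT + `hHalf`.**
References: [LawsonWuthrich2016] §7.1; [SilvermanAEC2009] VIII.2, X.4.14; [McCallumLMS1991] §4 Lemma 4.6, §5; [Kolyvagin1989Izv] Thm. B₂.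
-/

set_option autoImplicit false
-- the Theorems namespace of this sub repeats the summit name by design (D-0017 nested layout)
set_option linter.dupNamespace false

noncomputable section

open scoped Classical AddSubgroup

namespace Summit.BirchSwinnertonDyer.BirchSwinnertonDyer.Theorems.GenusExact.PlusDescent

open WeierstrassCurve NumberField IsDedekindDomain Field Rat.HeightOneSpectrum Literature.NumberTheory.EllipticCurves
  Literature.NumberTheory.GaloisRepresentations Literature.NumberTheory.EllipticCurves.ModularForms AddSubgroup
  Literature.NumberTheory.EllipticCurves.RingClassField
open Summit.BirchSwinnertonDyer.BirchSwinnertonDyer.Theses.GenusKolyvaginAtTwo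
  (KolyvaginRelationAtTwo GrossZagierAllLevels MultPublishedInputsAtTwo EntireLFunctionRat MilneAnyModel)
open Summit.BirchSwinnertonDyer.BirchSwinnertonDyer.Theorems.GenusExact

universe u

/-- **`κ_n(m • Q) = ι_* κ_d(Q)`** for `d · m = n` (the Kummer classes of `Q` and `m • Q` at the two levels are the classes of `σ ↦ σR − R` for one
root `R`, `dR = Q`; inclusion `E[d] ↪ E[n]`). [cite: SilvermanAEC2009, VIII.§2 (independence of the chosen root)] [cite: McCallumLMS1991, §4 Lemma 4.6] -/
theorem kummerMapTorsion_zsmul_eq_torsionH1OfDvd {K₀ : Type u} [Field K₀] (V : WeierstrassCurve K₀) {d n : ℤ} (m : ℤ) (hmn : d * m = n)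
    (hdivd : ∀ P : geomPoints V, ∃ Q : geomPoints V, d • Q = P) (hdivn : ∀ P : geomPoints V, ∃ Q : geomPoints V, n • Q = P)
    (Q : V.toAffine.Point) :
    kummerMapTorsion V n hdivn (m • Q) = torsionH1OfDvd V (Dvd.intro m hmn) (kummerMapTorsion V d hdivd Q) := by
  set R := zsmulRoot V d hdivd Q with hR
  have hRQ : d • R = toGeomPoints V Q := zsmul_zsmulRoot V d hdivd Q
  have hRP : n • R = toGeomPoints V (m • Q) := by rw [← hmn, mul_comm, mul_smul, hRQ, ← map_zsmul]
  rw [kummerMapTorsion_apply V n, kummerMapTorsionFun_eq V n hdivn (m • Q) R hRP, kummerMapTorsion_apply V d]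
  change _ = torsionH1OfDvd V _ (kummerClassTorsion V d R (zsmul_zsmulRoot_mem V d hdivd Q))
  unfold kummerClassTorsion torsionH1OfDvd
  rw [resH1Hom_id_oneCocycleClass]
  congr 1

/-- **THE DESCENT HYPOTHESIS FROM THE LEVEL-4 HALVING BIT.**  Frame: `E/ℚ` elliptic with `ρ_{E,2^n}` onto for all `n`, `K` imaginary quadratic with
`d_K` odd and the two Theorem-B₂ non-squares.  If every `K`-rational point halvable by a point of `E(K̄)` fixed by `Γ_{K(E[4])}` is halvable in `E(K)`
(`hHalf`), then for every `K`-rational `P`, every level `M` and every point `Q` fixed by `Γ_{K(E[2^(M+2)])}` with `2^M Q = P`, the point `P` is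
`2^M`-divisible in `E(K)`.  Proof: the Kummer class `κ_(2^M)(P)` is `[σ ↦ σQ − Q]`, so it dies on `Γ_{K(E[2^(M+2)])}`; by Lawson–Wuthrich over `K` it is
`2`-torsion, so `2P ∈ 2^M E(K)` and (no `2`-torsion) `P = 2^(M−1) R₀`; then `κ_(2^M)(P) = ι κ₂(R₀)`, so `κ₂(R₀)` dies on `Γ_{K(E[2^(M+2)])}`, hence on
`Γ_{K(E[4])}` (KLW level reduction), i.e. the half of `R₀` is fixed by `Γ_{K(E[4])}`; `hHalf` halves `R₀` in `E(K)`.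
[cite: LawsonWuthrich2016, §7.1 and Lemma 3] [cite: SilvermanAEC2009, VIII.§2] -/
theorem exists_zsmul_eq_of_fixed_root_of_halvingBit
    (W : WeierstrassCurve ℚ) [W.IsElliptic] (K : Type) [Field K] [NumberField K] (hIQ : IsImaginaryQuadratic K)
    (hodd : Odd (NumberField.discr K)) (hsq1 : ¬ IsSquare ((NumberField.discr K : ℚ) * -|W.Δ|))
    (hsq2 : ¬ IsSquare ((NumberField.discr K : ℚ) * (-(2 * |W.Δ|)))) (hρ : ∀ n : ℕ, 0 < n → W.HasSurjectiveModNGaloisRep ((2 : ℤ) ^ n))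
    (hHalf : ∀ (R : (W.baseChange K).toAffine.Point) (Q : geomPoints (W.baseChange K)),
      (∀ ρ ∈ torsionFixing (W.baseChange K) (4 : ℤ), ρ • Q = Q) → (2 : ℤ) • Q = toGeomPoints (W.baseChange K) R →
      ∃ R' : (W.baseChange K).toAffine.Point, (2 : ℤ) • R' = R)
    (P : (W.baseChange K).toAffine.Point) (M : ℕ) (Q : geomPoints (W.baseChange K))
    (hQfix : ∀ ρ ∈ torsionFixing (W.baseChange K) ((2 ^ (M + 2) : ℕ) : ℤ), ρ • Q = Q)
    (hQ : ((2 ^ M : ℕ) : ℤ) • Q = toGeomPoints (W.baseChange K) P) :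
    ∃ R : (W.baseChange K).toAffine.Point, ((2 ^ M : ℕ) : ℤ) • R = P := by
  haveI : Fact (Nat.Prime 2) := ⟨Nat.prime_two⟩
  haveI hell : (W.baseChange K).IsElliptic := inferInstanceAs ((W.map (algebraMap ℚ K)).IsElliptic)
  rcases Nat.eq_zero_or_pos M with rfl | hMpos
  · exact ⟨P, by rw [pow_zero, Nat.cast_one, one_zsmul]⟩
  obtain ⟨m, rfl⟩ : ∃ m, M = m + 1 := ⟨M - 1, by omega⟩
  have h2 : Module.finrank ℚ K = 2 := hIQ.1
  have hs2 : W.HasSurjectiveModNGaloisRep 2 := by simpa using hρ 1 one_pos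
  have htorsK : ∀ (k : ℕ) (P : (W.baseChange K).toAffine.Point), ((2 ^ k : ℕ) : ℤ) • P = 0 → P = 0 := fun k P hP ↦
    EigenClassesFinite.forall_zsmul_two_pow_baseChange_eq_zero_of_hasSurjectiveModNGaloisRep_two W K h2 hs2 k P (by exact_mod_cast hP)
  have hbotK : AddSubgroup.torsionBy (W.baseChange K).toAffine.Point ((2 : ℕ) : ℤ) = ⊥ := by
    rw [eq_bot_iff]; intro P hP; rw [AddSubgroup.mem_bot]; exact htorsK 1 P (by simpa using hP)
  -- the Kummer class `c = κ_(2^M)(P) = [σ ↦ σQ − Q]`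
  have hn0 : ((2 ^ (m + 1) : ℕ) : ℤ) ≠ 0 := by positivity
  have hdivM : ∀ P : geomPoints (W.baseChange K), ∃ Q : geomPoints (W.baseChange K), ((2 ^ (m + 1) : ℕ) : ℤ) • Q = P :=
    (W.baseChange K).zsmul_geomPoints_surjective_of_charZero hn0
  have hdiv2 : ∀ P : geomPoints (W.baseChange K), ∃ Q : geomPoints (W.baseChange K), (2 : ℤ) • Q = P :=
    (W.baseChange K).zsmul_geomPoints_surjective_of_charZero two_ne_zero
  set δ := kummerMapTorsion (W.baseChange K) ((2 ^ (m + 1) : ℕ) : ℤ) hdivM with hδ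
  have hκ : δ P = kummerClassTorsion (W.baseChange K) ((2 ^ (m + 1) : ℕ) : ℤ) Q (by rw [hQ]; exact toGeomPoints_mem_fixedPoints _ _) := by
    rw [hδ, kummerMapTorsion_apply]
    exact kummerMapTorsionFun_eq (W.baseChange K) _ hdivM P Q hQ
  have hMle : torsionFixing (W.baseChange K) ((2 ^ (m + 1 + 2) : ℕ) : ℤ) ≤ torsionFixing (W.baseChange K) ((2 ^ (m + 1) : ℕ) : ℤ) :=
    KolyvaginLowerBoundAtTwo.torsionFixing_le_of_dvd _ (natCast_pow_dvd_natCast_pow (p := 2) (by omega))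
  have hc : ∀ ρ ∈ torsionFixing (W.baseChange K) ((2 ^ (m + 1 + 2) : ℕ) : ℤ), h1Eval (W.baseChange K) ((2 ^ (m + 1) : ℕ) : ℤ) (δ P) ρ = 0 := by
    intro ρ hρ
    rw [hκ, ← ZeroMemClass.coe_eq_zero, GenusKolyTwistingPrime.coe_h1Eval_kummerClassTorsion (W.baseChange K) _ Q _ (hMle hρ), hQfix ρ hρ,
      sub_self]
  -- `2c = 0` (Lawson–Wuthrich over `K`, at level `2^(M+2)`)
  have hdvd2 : ((2 ^ (m + 1) : ℕ) : ℤ) ∣ ((2 ^ (m + 1 + 2) : ℕ) : ℤ) := natCast_pow_dvd_natCast_pow (p := 2) (by omega)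
  have hιinj : Function.Injective (torsionH1OfDvd (W.baseChange K) hdvd2) :=
    VisiblePairAtTwo.torsionH1OfDvd_pow_injective (W.baseChange K) (p := 2) hbotK hdvd2
  have h2c : (2 : ℤ) • δ P = 0 := by
    apply hιinj
    rw [map_zsmul, map_zero]
    refine VisiblePairAtTwo.two_zsmul_eq_zero_of_forall_h1Eval_eq_zero_habitat W K (m + 1 + 2) hIQ hodd hsq1 hsq2 hρ _ fun ρ ↦ ?_
    exact (Lw2PhantomExclusion.h1Eval_torsionH1OfDvd_eq_zero_iff (W.baseChange K) hdvd2 _ ρ.2).mpr (hc ρ.1 ρ.2)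
  -- `2P = 2^M R₀`, hence `P = 2^(M−1) R₀`
  obtain ⟨R₀, hR₀⟩ : ∃ R₀ : (W.baseChange K).toAffine.Point, ((2 ^ (m + 1) : ℕ) : ℤ) • R₀ = (2 : ℤ) • P := by
    have hmem : (2 : ℤ) • P ∈ (kummerMapTorsion (W.baseChange K) ((2 ^ (m + 1) : ℕ) : ℤ) hdivM).ker := by
      rw [AddMonoidHom.mem_ker, map_zsmul, ← hδ, h2c]
    rw [kummerMapTorsion_ker] at hmem
    obtain ⟨R₀, hR₀⟩ := hmem
    exact ⟨R₀, by simpa using hR₀⟩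
  have hP : P = ((2 ^ m : ℕ) : ℤ) • R₀ := by
    have h0 : (2 : ℤ) • (P - ((2 ^ m : ℕ) : ℤ) • R₀) = 0 := by
      rw [zsmul_sub, smul_smul, show (2 : ℤ) * ((2 ^ m : ℕ) : ℤ) = ((2 ^ (m + 1) : ℕ) : ℤ) by push_cast; ring, hR₀, sub_self]
    exact sub_eq_zero.mp (htorsK 1 _ (by simpa using h0))
  -- `c = ι κ₂(R₀)`; so `κ₂(R₀)` dies on `Γ_{K(E[2^(M+2)])}`, hence on `Γ_{K(E[4])}` (KLW)
  have hmn : (2 : ℤ) * ((2 ^ m : ℕ) : ℤ) = ((2 ^ (m + 1) : ℕ) : ℤ) := by push_cast; ring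
  have hcι : δ P = torsionH1OfDvd (W.baseChange K) (Dvd.intro _ hmn) (kummerMapTorsion (W.baseChange K) (2 : ℤ) hdiv2 R₀) := by
    rw [hP]
    exact kummerMapTorsion_zsmul_eq_torsionH1OfDvd (W.baseChange K) _ hmn hdiv2 hdivM R₀
  have hz : ∀ ρ ∈ torsionFixing (W.baseChange K) ((2 ^ (m + 1 + 2) : ℕ) : ℤ),
      h1Eval (W.baseChange K) (2 : ℤ) (kummerMapTorsion (W.baseChange K) (2 : ℤ) hdiv2 R₀) ρ = 0 := by
    intro ρ hρ
    have h := hc ρ hρ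
    rw [hcι, Lw2PhantomExclusion.h1Eval_torsionH1OfDvd_eq_zero_iff (W.baseChange K) (Dvd.intro _ hmn) _ (hMle hρ)] at h
    exact h
  have hz4 := Lw2PhantomExclusion.forall_torsionFixing_four_h1Eval_eq_zero_of_pow_baseChange W hρ hIQ hodd hsq1 hsq2 (M := m + 1 + 2)
    (by omega) hz
  -- the half `Q₂` of `R₀` is fixed by `Γ_{K(E[4])}`
  set Q₂ := zsmulRoot (W.baseChange K) (2 : ℤ) hdiv2 R₀ with hQ₂
  have hQ₂R : (2 : ℤ) • Q₂ = toGeomPoints (W.baseChange K) R₀ := zsmul_zsmulRoot (W.baseChange K) _ hdiv2 R₀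
  have h42 : torsionFixing (W.baseChange K) (4 : ℤ) ≤ torsionFixing (W.baseChange K) (2 : ℤ) :=
    KolyvaginLowerBoundAtTwo.torsionFixing_le_of_dvd _ (by norm_num)
  have hκ₂ : kummerMapTorsion (W.baseChange K) (2 : ℤ) hdiv2 R₀ =
      kummerClassTorsion (W.baseChange K) (2 : ℤ) Q₂ (by rw [hQ₂R]; exact toGeomPoints_mem_fixedPoints _ _) := by
    rw [kummerMapTorsion_apply]
    exact kummerMapTorsionFun_eq (W.baseChange K) _ hdiv2 R₀ Q₂ hQ₂R
  have hQ₂fix : ∀ ρ ∈ torsionFixing (W.baseChange K) (4 : ℤ), ρ • Q₂ = Q₂ := by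
    intro ρ hρ
    have h := hz4 ρ hρ
    rw [hκ₂, ← ZeroMemClass.coe_eq_zero, GenusKolyTwistingPrime.coe_h1Eval_kummerClassTorsion (W.baseChange K) _ Q₂ _ (h42 hρ),
      sub_eq_zero] at h
    exact h
  obtain ⟨R', hR'⟩ := hHalf R₀ Q₂ hQ₂fix hQ₂R
  refine ⟨R', ?_⟩
  rw [hP, ← hR', smul_smul, mul_comm, hmn]

/-- **K4Neg's CONCLUSION on ANY `Δ < 0` K₄⁻-type frame — no cut, any reduction at `2`, in particular on the phantom cell F4ᵖᵍ — from `BSD₂(E)`,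
`BSD₂(Wd)`, Q2, the four PRINT items and the LEVEL-4 HALVING BIT `hHalf`** («a `K`-rational point halvable by a `Γ_{K(E[4])}`-fixed point is
halvable in `E(K)`»; on the rank-one cell: the generator of `E(K) ⊗ ℤ₂` is not halvable over `K(E[4])`, i.e. its Kummer class is not the
Lawson–Wuthrich phantom, i.e. `ξ_E` is not the twin's `2`-Selmer class — decidable per frame by `2`-descent on `Wd`).  `…PhantomCellSupply`'s
`kFourNeg_conclusion_of_bsdp_pair_of_heegnerDescent` with its all-level hypothesis `hDesc` discharged from `hHalf`
(`exists_zsmul_eq_of_fixed_root_of_halvingBit`) and `y_K` taken from the datum.  BSD is NOT proved; K4Neg is NOT proved (hypotheses: BSD₂ of the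
pair, Q2, PRINT, `hHalf`). [cite: McCallumLMS1991, §5 Thm. 5.4] [cite: Kolyvagin1989Izv, Thm. B₂] [cite: LawsonWuthrich2016, §7.1]
[cite: SilvermanAEC2009, Thm. X.4.14] -/
theorem kFourNeg_conclusion_of_bsdp_pair_of_halvingBit (hQ2 : KolyvaginRelationAtTwo)
    (hGZ : GrossZagierAllLevels) (hGZK : MultPublishedInputsAtTwo) (hL : EntireLFunctionRat) (hMi : MilneAnyModel)
    (W : WeierstrassCurve ℚ) [W.IsElliptic] [W.IsGloballyMinimal] [NeZero (W.conductorNorm ℤ)]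
    (hcm : ¬ W.HasCM) (hr0 : W.analyticRank = 0) (hρ : ∀ n : ℕ, 0 < n → W.HasSurjectiveModNGaloisRep ((2 : ℤ) ^ n))
    (hT : Odd W.tamagawaProduct) (hneg : W.Δ < 0)
    (K : Type) [Field K] [NumberField K] (hIQ : IsImaginaryQuadratic K) (hodd : Odd (NumberField.discr K))
    (h3 : NumberField.discr K ≠ -3) (hHe : SatisfiesHeegnerHypothesis (W.conductorNorm ℤ) K)
    (hsq1 : ¬ IsSquare ((NumberField.discr K : ℚ) * -|W.Δ|)) (hsq2 : ¬ IsSquare ((NumberField.discr K : ℚ) * (-(2 * |W.Δ|))))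
    (Dt : ModularParametrizationData W (W.conductorNorm ℤ)) (hc : Odd Dt.c)
    (β : ℤ) (ι : K →+* ℂ) (d₁ : KolyvaginHeegnerData Dt β ι 1) (hy : ¬ IsOfFinAddOrder d₁.derivedPoint)
    (M₀ : ℕ) (hdiv : ∃ Q : (W.baseChange (ringClassField K ι 1)).toAffine.Point, ((2 ^ M₀ : ℕ) : ℤ) • Q = d₁.derivedPoint)
    (hndiv : ¬ ∃ Q : (W.baseChange (ringClassField K ι 1)).toAffine.Point, ((2 ^ (M₀ + 1) : ℕ) : ℤ) • Q = d₁.derivedPoint)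
    (hM₀ : 1 ≤ M₀)
    (Wd : WeierstrassCurve ℚ) [Wd.IsElliptic] [Wd.IsGloballyMinimal]
    (hWd : ∃ C : VariableChange ℚ, C • W.quadraticTwist (NumberField.discr K : ℚ) = Wd)
    (hrd : Wd.analyticRank = 1) (hSel : Nat.card (Wd.selmerGroup 2) = 2) (hDEF : padicValNat 2 Wd.tamagawaProduct ≤ 1)
    (hBW : BSDp W 2) (hBd : BSDp Wd 2)
    (hHalf : ∀ (R : (W.baseChange K).toAffine.Point) (Q : geomPoints (W.baseChange K)),
      (∀ ρ ∈ torsionFixing (W.baseChange K) (4 : ℤ), ρ • Q = Q) → (2 : ℤ) • Q = toGeomPoints (W.baseChange K) R →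
      ∃ R' : (W.baseChange K).toAffine.Point, (2 : ℤ) • R' = R) :
    ∃ (n : ℕ) (d : KolyvaginHeegnerData Dt β ι n), Squarefree n ∧
      (∀ ℓ ∈ n.primeFactors, Zhang2014.IsKolyvaginPrime (W.conductorNorm ℤ) W K 2 ℓ ∧ 2 ≤ Zhang2014.kolyvaginIndex W 2 ℓ ∧
        FrobEqFrobInfty W K 2 ℓ) ∧
      ¬ ∃ Q : (W.baseChange (ringClassField K ι n)).toAffine.Point, (2 : ℤ) • Q = d.derivedPoint := by
  obtain ⟨Ph, -, hPh⟩ := AdditiveKoly.exists_isHeegnerPoint_map_eq_derivedPoint_one (W := W) (K := K) (Dt := Dt) (β := β) (ι := ι) hIQ hHe d₁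
  exact kFourNeg_conclusion_of_bsdp_pair_of_heegnerDescent hQ2 hGZ hGZK hL hMi W hcm hr0 hρ hT hneg K hIQ hodd h3 hHe hsq1 hsq2 Dt hc β ι d₁ hy
    Ph hPh M₀ hdiv hndiv hM₀ Wd hWd hrd hSel hDEF hBW hBd
    (fun M b Q hfix hQ ↦ exists_zsmul_eq_of_fixed_root_of_halvingBit W K hIQ hodd hsq1 hsq2 hρ hHalf (b • Ph) M Q hfix hQ)

end Summit.BirchSwinnertonDyer.BirchSwinnertonDyer.Theorems.GenusExact.PlusDescent

end
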